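import Summits.AnomalousDissipation.AnomalousDissipation.Theorems.BaireTransferRobustLoudUpgradeLine

/-!
# Stub `stub_splitGlue` of the line `malkin-cone-group-orbits` (crux stmt-AnomalousDissipation-1144,
# `BaireTransfer.RobustLoudUpgrade`; lead c15, census split D2)

The STEADY half of the upgrade (witnesses = classical steady states of ANY mean, sharp-to-relaxed budgets)
and the GENUINELY PERIODIC half (witnesses = time-periodic classical solutions that are NOT constant in
time) together imply the crux `RobustLoudUpgrade`.  A loud witness `(ν, τ, u, p)` of `loud S a E ε` is
either constant in time — then `(u 0, p 0)` is a classical steady state of `NS_ν(f_c)`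
(`Torus.IsSteadyNSState`, definitionally `IsClassicalNSSolutionOn univ` on constant data) with the same
mean energy and mean dissipation — or genuinely periodic; the two stocks are joined by union.

No analysis beyond: the one-sided time derivative of a constant curve vanishes, and a time slice of a
jointly smooth pressure is smooth (`IsSmoothSpaceTimeOn.isSmooth_slice`, `isSmoothSpaceTimeOn_const`).
-/

-- `Summit.<Summit>.<Problem>` is the tree's mandated summit-side namespace (CONVENTIONS §2); for this
-- single-conjunct summit the two coincide, so the duplicate is deliberate.
set_option linter.dupNamespace false

noncomputable section

open scoped BigOperators Topology
open Filter Set Function TopologicalSpace MeasureTheory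

namespace Summit.AnomalousDissipation.AnomalousDissipation.Theorems.RobustLoudUpgrade.Category

open Literature.Analysis.FunctionSpaces Literature.Analysis.FunctionSpaces.Torus
open Literature.Analysis.FluidPDE
open Summit.AnomalousDissipation.AnomalousDissipation.Theses.BaireTransfer

/-- The one-sided time derivative (within any time set) of a constant-in-time field vanishes. [folklore] -/
theorem timeDerivWithin_const_curve {F : Type*} [NormedAddCommGroup F] [NormedSpace ℝ F]
    (T : Set ℝ) (v : UnitAddTorus (Fin 3) → F) (t : ℝ) (x : UnitAddTorus (Fin 3)) :
    Torus.timeDerivWithin T (fun _ : ℝ => v) t x = 0 := by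
  simp [Torus.timeDerivWithin]

/-- **A classical solution on `ℝ × T³` with a time-independent force that is constant in time is a classical
steady state**: `(u 0, p 0)` satisfies `Torus.IsSteadyNSState ν f (u 0) (p 0)` (the momentum equation at
time `0`, whose time-derivative term vanishes, is the steady equation; the pressure slice `p 0` is smooth).
[folklore] -/
theorem isSteadyNSState_of_forall_eq {ν : ℝ} {f : UnitAddTorus (Fin 3) → EuclideanSpace ℝ (Fin 3)}
    {u : ℝ → UnitAddTorus (Fin 3) → EuclideanSpace ℝ (Fin 3)} {p : ℝ → UnitAddTorus (Fin 3) → ℝ}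
    (hsol : IsClassicalNSSolutionOn Set.univ ν (fun _ => f) u p) (h : ∀ t, u t = u 0) :
    Torus.IsSteadyNSState ν f (u 0) (p 0) := by
  have hu : u = fun _ => u 0 := funext h
  refine ⟨?_, isSmoothSpaceTimeOn_const (hsol.smooth_pressure.isSmooth_slice (Set.mem_univ 0)) _,
    fun t _ x => ?_, fun _ _ => hsol.divFree 0 (Set.mem_univ 0)⟩
  · -- the velocity `fun _ => u 0` IS `u`
    rw [← hu]
    exact hsol.smooth_velocity
  · -- momentum: the equation at time `0`, both time derivatives being `0`
    have hm := hsol.momentum 0 (Set.mem_univ 0) x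
    rw [hu, timeDerivWithin_const_curve, zero_add] at hm
    rw [timeDerivWithin_const_curve, zero_add]
    exact hm

/-- **stub_splitGlue** (registered sub-goal of the line `malkin-cone-group-orbits`, lead c15; census D2 as a
theorem).  The STEADY half of the upgrade (witnesses = classical steady states of ANY mean, sharp-to-relaxed
budgets) and the PERIODIC half (witnesses = time-periodic classical solutions that are NOT constant in time)
together imply the crux: a loud witness is either constant in time — then `(u 0, p 0)` is a classical steady
state with the same budgets — or genuinely periodic; stocks are joined by union. [folklore] -/
theorem stub_splitGlue :
    (∃ S₀ : Finset (Fin 3 → ℤ), ∀ S : Finset (Fin 3 → ℤ), S₀ ⊆ S → ∀ (E ε : ℝ), 0 < ε → ∀ j : ℕ,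
      {c : Coeff S | ∃ ν : ℝ, 0 < ν ∧ ν < 1 / ((j : ℝ) + 1) ∧
        ∃ (u : UnitAddTorus (Fin 3) → EuclideanSpace ℝ (Fin 3)) (p : UnitAddTorus (Fin 3) → ℝ),
          Torus.IsSteadyNSState ν (force S c) u p ∧ meanEnergy (fun _ : ℝ => u) ≤ E ∧
            ε ≤ meanDissipation ν (fun _ : ℝ => u)} ⊆
        closure (interior (loud S (1 / ((j : ℝ) + 1)) (2 * E) (ε / 2)))) →
    (∃ S₀ : Finset (Fin 3 → ℤ), ∀ S : Finset (Fin 3 → ℤ), S₀ ⊆ S → ∀ (E ε : ℝ), 0 < ε → ∀ j : ℕ,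
      {c : Coeff S | ∃ ν : ℝ, 0 < ν ∧ ν < 1 / ((j : ℝ) + 1) ∧
        ∃ (τ : ℝ) (u : ℝ → UnitAddTorus (Fin 3) → EuclideanSpace ℝ (Fin 3)) (p : ℝ → UnitAddTorus (Fin 3) → ℝ), 0 < τ ∧
          IsClassicalNSSolutionOn Set.univ ν (fun _ => force S c) u p ∧ Function.Periodic u τ ∧ (∃ t, u t ≠ u 0) ∧
            meanEnergy u ≤ E ∧ ε ≤ meanDissipation ν u} ⊆
        closure (interior (loud S (1 / ((j : ℝ) + 1)) (2 * E) (ε / 2)))) →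
    RobustLoudUpgrade := by
  rintro ⟨S₁, h₁⟩ ⟨S₂, h₂⟩
  rw [crux_iff]
  refine ⟨S₁ ∪ S₂, fun S hS E ε hε j c hc => ?_⟩
  obtain ⟨hS₁, hS₂⟩ := Finset.union_subset_iff.1 hS
  obtain ⟨ν, hν, hνa, τ, u, p, hτ, hsol, hper, hE, hD⟩ := hc
  by_cases h : ∃ t, u t ≠ u 0
  · -- genuinely periodic witness: hypothesis 2
    exact h₂ S hS₂ E ε hε j ⟨ν, hν, hνa, τ, u, p, hτ, hsol, hper, h, hE, hD⟩
  · -- constant-in-time witness: `(u 0, p 0)` is a classical steady state with the same budgets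
    push Not at h
    have hu : u = fun _ => u 0 := funext h
    refine h₁ S hS₁ E ε hε j ⟨ν, hν, hνa, u 0, p 0, isSteadyNSState_of_forall_eq hsol h, ?_, ?_⟩
    · rw [← hu]; exact hE
    · rw [← hu]; exact hD

end Summit.AnomalousDissipation.AnomalousDissipation.Theorems.RobustLoudUpgrade.Category

end
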